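import Summits.AnomalousDissipation.AnomalousDissipation.Theses.TwoAndHalfD
import Literature.Analysis.FluidPDE.TorusClassicalLerayHopfProofs
import Literature.Analysis.FluidPDE.PassiveScalarWellPosedness
import Literature.Analysis.FluidPDE.PassiveScalarClassicalEnergy
import Literature.Analysis.FluidPDE.LongTimeAverageSlidingWindow
import Literature.Barriers.AnomalousDissipation.GravestModeLaminarAttractorSwept
import Summits.AnomalousDissipation.AnomalousDissipation.Theorems.ScalarAnomalySteadySourceFormal.Negative.ForcedClassicalWeak
import Summits.AnomalousDissipation.AnomalousDissipation.Theorems.TwoAndHalfDScalarAnomalySteadySourceFormalColdStartVariance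
import Summits.AnomalousDissipation.AnomalousDissipation.Theorems.TwoAndHalfDTwohalfdThesisStubWeakDuhamel
import Summits.AnomalousDissipation.AnomalousDissipation.Theorems.TwoAndHalfDScalarAnomalySteadySourceFormalReleaseNormSqMeasurable
import Summits.AnomalousDissipation.AnomalousDissipation.Theorems.TwoAndHalfDScalarAnomalySteadySourceFormalMeanSquareDuhamelVariance
import Summits.AnomalousDissipation.AnomalousDissipation.Theorems.TwoAndHalfDScalarAnomalySteadySourceFormalDissipationFloorOfMeanVariance
import Summits.AnomalousDissipation.AnomalousDissipation.Theorems.TwoAndHalfDScalarAnomalySteadySourceFormalMeanSquareOfReleasedMixingWitness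

/-!
# Line `budgeted-mixer-template` for crux `TwoAndHalfD.ScalarAnomalySteadySourceFormal`
# (stmt-AnomalousDissipation-0448) — lead's skeleton, RESHAPE r2 (2026-08-17, lead c2)

Idea card `Cruxes/ScalarAnomalySteadySourceFormal/Ideas/budgeted-mixer-template.md`; line card
`Lines/budgeted-mixer-template.md`; reshape r1 (leads c0/c1) = `Lines/budgeted_mixer_template.lean` @ tree before this
commit: residual S1' `stub_profileMixerRealizable` + LANDED S2 p82838 (toolkit p79560), S3 p84739, S4 p85485, S5 p89281
(toolkit p87216), transfer `stub_profileMixerTransfer : S1' → crux` p89816, c1 tools p116474 / p116923 / p118298.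

WHY RESHAPE r2.  S1' (like the sibling crux 0206's kernel W `TwohalfdThesis.stub_releasedMixingWitness`, and S1' ⇒ W is
landed, p132866) asks two things the crux never uses: (i) `L²` decay of the releases of the profile `h` from EVERY start
time under ONE deterministic majorant — a single chaotic trajectory recurs near unstable quiescent states, so
sup-over-release-time envelopes are implausible even where the time-AVERAGED mixing the crux needs holds; (ii) a
cold-start input floor at one lag from EVERY start time (c1's DNS: the uniform-in-`s` floor is negative at short lags even
at `ν = 10⁻³`).  The crux's scalar clauses are `limsup`/`liminf` time means.  So the residual is re-typed STATISTICALLY: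

* S1'' `stub_meanSquareMixerRealizable` — TRANSFER TARGET `C⁺` (residual crux; XL, OPEN; held by the lead): W's body with
  the pointwise envelope replaced by MEAN-SQUARE decay of the releases averaged over the release time,
  `∫_{s₀}^{T} ‖φ_{j,s}(s+τ)‖² ds ≤ (B + T − s₀)·m(τ)²‖h‖²` for every lag `τ ≥ 0` and `T ≥ s₀` (`m > 0` antitone,
  `∫₀ᵗ m ≤ M`), and the floor in W's liminf-mean Green–Kubo form.  W ⇒ S1'' (J3 below) and S1' ⇒ W (landed) make S1''
  the WEAKEST open kernel of the route; every no-go for S1'' is a no-go for W and S1'.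
* T3a `stub_releaseNormSqMeasurable` (M) — LANDED p147918 (`Theorems/…ReleaseNormSqMeasurable.lean`): joint Borel measurability of `(s,t) ↦ ‖φ_s(t)‖²` on `0 ≤ s ≤ t` for the classical
  releases of one smooth datum (duality ⇒ continuity in `s` of the pairings with the smooth real Fourier modes, continuity
  in `t`, Carathéodory ⇒ joint measurability, Parseval ⇒ countable sum).  Needed to make the release-time integrals honest.
* T3 `stub_meanSquareDuhamelVariance` (L) — LANDED p149045 (`Theorems/…MeanSquareDuhamelVariance.lean`): weak Duhamel (D0, landed p87403) + (MS) ⇒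
  `∫₀ᵀ ‖θ(t)‖² dt ≤ (2s₀²T + 2M²(B+T))‖h‖²` for the cold start `θ`: `‖θ(t)‖ ≤ ∫₀ᵗ‖φ_s(t)‖ds`, early part `≤ s₀‖h‖`,
  late part by Cauchy–Schwarz with the weight `m(t−s)`, then ONE Tonelli swap on the release triangle and the two
  substitutions `s = t − τ`, `t = s + τ` turn the `t`-integral of the weighted Duhamel integral into the (MS) quantities.
* D2' `stub_dissipationFloorOfMeanVariance` (M) — LANDED p149892 (`Theorems/…DissipationFloorOfMeanVariance.lean`): liminf-mean input power `≥ ε` + `∫₀ᵀ‖θ‖² ≤ a + bT` ⇒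
  `⟨κ‖∇θ‖²⟩ ≥ ε` (the sourced `L²` balance in Cesàro form as in D2 p89988, plus `‖θ(T)‖² = o(T)` from
  `d/dt √(‖θ‖²+1) ≤ ‖h‖`).
* J3 `stub_meanSquare_of_releasedMixingWitness` (M−) — LANDED p151094 (`Theorems/…MeanSquareOfReleasedMixingWitness.lean`): W ⇒ S1'' (running infimum of W's envelope + `e^{-τ}`; no
  measurability needed: `integral_mono_of_nonneg`).
`ScalarAnomalySteadySourceFormal_of` composes S1'', T3a, T3, D2' with the landed D0 and `exists_global_coldStart` into
the crux BY NAME; after wave 1 (all four transfer stubs ACCEPTED) its ONLY `sorry` is S1''.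
TREE COMPANIONS (all ACCEPTED, `--supports` this item): transfer `MeanSquareMixerTransfer.stub_meanSquareMixerTransfer`
(p151902: S1''-body ⇒ crux, `twohalfdThesis_of_meanSquareMixer`, and `meanSquareMixer_of_profileMixerRealizable` =
S1' ⇒ S1'' via J2 ∘ J3); tool `MeanSquareLipschitzNoGo.stub_meanSquareLipschitzNoGo` (p152468: (MS) is incompatible with
`j`-uniformly Lipschitz drifts along `ν_j → 0` — S1''-witnesses need unbounded gradients exactly like S1'-witnesses); honesty
certificate `MeanSquareBodyFixedViscosity.stub_meanSquareBodyFixedViscosity` (p154122: at every FIXED viscosity the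
S1''-body holds for the rest flow with the heat releases of `cos 2πx₁` — the clause set is consistent and `ν_j → 0` is its
only load-bearing asymptotic).

DISPROOF / NEGATIVES HONOURED (Disproof.lean @844557de, WITNESS-CONSTRAINTS.md): S1'' keeps ONE fixed smooth `(g, h)`,
`ν_j → 0`, pointwise (honest) energy; its witnesses are not at rest / Galilean / shear–drift / uniformly band-limited /
Wiener-class (§6, §8, §9, §10, §12: mean-square decay with an integrable `m` still forces `j`-unbounded gradients, cf.
`ReleaseL2Floor.decay_clause_not_uniformlyLipschitz` for the pointwise clause); the GK clause is junk-proof (a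
non-integrable pairing makes the liminf `0 < ε` fail) and `h = 0` is excluded by it; (MS) is USED only through honest
integrals (T3a supplies measurability, contraction supplies boundedness).
-/

noncomputable section

namespace Summit.AnomalousDissipation.AnomalousDissipation.Cruxes.ScalarAnomalySteadySourceFormal.BudgetedMixerTemplate

open MeasureTheory Filter Topology Set
open scoped ENNReal NNReal
open Literature.Analysis.FunctionSpaces Literature.Analysis.FluidPDE

set_option linter.dupNamespace false

/-! ## S1'' — the statistical transfer target `C⁺` (mean-square release decay + Green–Kubo floor) -/

/-- **S1'' `stub_meanSquareMixerRealizable` — TRANSFER TARGET `C⁺` (the residual crux; XL, OPEN).**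
There are a smooth divergence-free mean-zero steady planar force `g`, a smooth mean-zero profile `h`, viscosities
`ν_j → 0`, CLASSICAL solutions `(v_j, p_j)` of the planar Navier–Stokes system forced by `g` on `[0, ∞) × T²` (data
free), the classical released families `φ_j s` (unforced unit-Prandtl scalar over `v_j` on `[s, ∞)` with datum `h` at
time `s ≥ 0`; unique, merely named), an antitone rate function `m > 0` with `∫₀ᵗ m ≤ M`, a spin-up time `s₀ ≥ 0`, a
transient allowance `B ≥ 0`, an energy level `E` and a floor `ε > 0` such that for every `j`:
* (energy)      `∫‖v_j(t)‖² ≤ E` for all `t ≥ 0`;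
* (mean-square) `∫_{s₀}^{T} ‖φ_j s (s+τ)‖²_{L²} ds ≤ (B + (T − s₀))·m(τ)²‖h‖²_{L²}` for all `τ ≥ 0`, `T ≥ s₀` — the
                releases of `h` decay at the integrable rate `m` ON AVERAGE over the release time (rare unmixed
                episodes allowed), uniformly in `j`;
* (GK floor)    `ε ≤ liminf_T T⁻¹∫₀ᵀ (∫₀ᵗ (h, φ_j s(t)) ds) dt` — the input power of the cold start in liminf mean.
Why plausibly true / why it might fail: it is the weakest typed form of the route's dynamical bet — steady forcing
sustains, on some bounded-energy invariant set, stirring that dissipates ONE fixed profile on `ν`-independent MEAN times;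
necessarily `⟨‖∇v_j‖⟩ ≳ log(1/ν_j)` (strain gate p111103, log gate p91755), no uniform band limit (Disproof §10), spectral
reach `≳ ν_j^{-1/2}` (§11); against it: the Batchelor logarithm of the enstrophy-cascade phenomenology (c1 assessment
§2(e): sourced variance `≳ χ (log 1/ν)^{1/2}`), which no time-averaging removes.  `¬S1''` for all `(g,h)` is a uniform
mixing-rate ceiling feeding `TwohalfdNeg`.  Size XL. -/
theorem stub_meanSquareMixerRealizable :
    ∃ (g : UnitAddTorus (Fin 2) → EuclideanSpace ℝ (Fin 2)) (h : UnitAddTorus (Fin 2) → ℝ),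
      Torus.IsSmooth g ∧ Torus.IsDivFree g ∧ Torus.HasZeroMean g ∧ Torus.IsSmooth h ∧ Torus.HasZeroMean h ∧
      ∃ (ν : ℕ → ℝ) (v : ℕ → ℝ → UnitAddTorus (Fin 2) → EuclideanSpace ℝ (Fin 2))
        (p : ℕ → ℝ → UnitAddTorus (Fin 2) → ℝ) (φ : ℕ → ℝ → ℝ → UnitAddTorus (Fin 2) → ℝ)
        (m : ℝ → ℝ) (E s₀ B M ε : ℝ),
        (∀ j, 0 < ν j) ∧ Tendsto ν atTop (𝓝 0) ∧
        (∀ j, Torus.IsClassicalNSSolutionOn (Set.Ici 0) (ν j) (fun _ => g) (v j) (p j)) ∧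
        (∀ j t, 0 ≤ t → ∫ x, ‖v j t x‖ ^ 2 ≤ E) ∧
        (∀ j s, 0 ≤ s → Torus.IsClassicalScalarTransportOn (Set.Ici s) (ν j) (v j) (φ j s) ∧ φ j s s = h) ∧
        0 ≤ s₀ ∧ 0 ≤ B ∧ Antitone m ∧ (∀ τ, 0 < m τ) ∧ (∀ t, 0 ≤ t → ∫ τ in (0 : ℝ)..t, m τ ≤ M) ∧
        (∀ j τ T, 0 ≤ τ → s₀ ≤ T →
          ∫ s in s₀..T, Torus.scalarL2Sq (φ j s (s + τ)) ≤ (B + (T - s₀)) * m τ ^ 2 * Torus.scalarL2Sq h) ∧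
        0 < ε ∧
        (∀ j, ε ≤ liminf (timeMean fun t => ∫ s in (0 : ℝ)..t, ∫ x, h x * φ j s t x) atTop) := by
  sorry

/-! ## T3a — joint measurability of the release norms -/

/-- **T3a `stub_releaseNormSqMeasurable` (M).**  For `κ > 0`, a smooth datum `h` and classical unforced releases `φ s`
of `h` at every `s ≥ 0` over one drift (jointly smooth and divergence free on `[0, ∞)` by the structure at `s = 0`),
the map `(s, t) ↦ ‖φ s (t)‖²_{L²}` agrees on `{0 ≤ s ≤ t}` with a Borel measurable function on `ℝ × ℝ`.
PROOF ROUTE: Parseval for the continuous slice (`Torus.hasSum_sq_mFourierCoeff_ofReal`):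
`‖φ s t‖² = Σ_k |𝓕(φ s t)(k)|²`, and `|𝓕(·)(k)|² = (∫ aₖ φ s t)² + (∫ bₖ φ s t)²` with the smooth real modes
`aₖ = re ∘ e₋ₖ`, `bₖ = im ∘ e₋ₖ` (`(Torus.isSmooth_mFourier _).comp_clm Complex.reCLM/imCLM`).  For a smooth real `χ`
the clamped pairing `Q(s,t) := ∫ χ · φ (s⁺) (max t s⁺)`, `s⁺ = max s 0`, is continuous in `t` for each `s` (smooth slice
path, `IsSmoothSpaceTimeOn.continuousOn_integral`) and continuous in `s` for each `t` (constant for `s ≤ 0` and for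
`s ≥ t`, and on `[0, t]` equal to the continuous `D` of `GKFloorOfTailTools.exists_continuousOn_releasePairing`
generalised to the test function `χ` — reversed problem from `χ`, `integral_mul_eq_of_reverse_shifted`; the pieces
match at `s = 0` and `s = t` since `φ t t = h`), hence jointly (strongly) measurable by
`stronglyMeasurable_uncurry_of_continuous_of_stronglyMeasurable` (Carathéodory); the countable sum is measurable
(`Measurable.ennreal_tsum`, `ENNReal.ofReal_tsum_of_nonneg`, `toReal`).  [folklore] -/
theorem stub_releaseNormSqMeasurable :
    ∀ (κ : ℝ) (u : ℝ → UnitAddTorus (Fin 2) → EuclideanSpace ℝ (Fin 2)) (h : UnitAddTorus (Fin 2) → ℝ)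
      (φ : ℝ → ℝ → UnitAddTorus (Fin 2) → ℝ),
      0 < κ → Torus.IsSmooth h →
      (∀ s, 0 ≤ s → Torus.IsClassicalScalarTransportOn (Set.Ici s) κ u (φ s) ∧ φ s s = h) →
      ∃ G : ℝ × ℝ → ℝ, Measurable G ∧ ∀ s t, 0 ≤ s → s ≤ t → G (s, t) = Torus.scalarL2Sq (φ s t) :=
  Summit.AnomalousDissipation.AnomalousDissipation.Theorems.ScalarAnomalySteadySourceFormal.ReleaseNormSqMeasurable.stub_releaseNormSqMeasurable

/-! ## T3 — mean-square Duhamel: the integrated variance of the cold start -/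

/-- **T3 `stub_meanSquareDuhamelVariance` (L; the lead's stub).**  Let `κ > 0`, `h` smooth, `θ` the classical cold start
(`∂ₜθ + u·∇θ = κΔθ + h` on `[0, ∞)`, `θ(0) = 0`), `φ s` the classical releases of `h` (`s ≥ 0`), ASSUME the weak Duhamel
identity (conclusion of D0 `TwohalfdThesis.stub_weakDuhamel`, fed in by the composition), a Borel measurable `G` agreeing
with `‖φ s (t)‖²` on `0 ≤ s ≤ t` (conclusion of T3a), an antitone `m > 0` with `∫₀ᵗ m ≤ M` (`t ≥ 0`), `s₀, B ≥ 0` and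
the MEAN-SQUARE decay `∫_{s₀}^{T} ‖φ s (s+τ)‖² ds ≤ (B + (T − s₀)) m(τ)²‖h‖²` (`τ ≥ 0`, `T ≥ s₀`).  THEN for every
`T ≥ 0`: `∫₀ᵀ ‖θ(t)‖²_{L²} dt ≤ (2 s₀² T + 2 M² (B + T)) ‖h‖²_{L²}`.
PROOF ROUTE: `χ := θ t` in the identity and Cauchy–Schwarz in `x` (`ColdStartVariance.integral_mul_le_sqrt_mul_sqrt`)
give `‖θ(t)‖² ≤ ‖θ(t)‖ ∫₀ᵗ √G(s,t) ds` (the `s`-integrand is measurable by T3a and `≤ ‖h‖` by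
`IsClassicalScalarTransportOn.antitoneOn_scalarL2Sq`, so every integral below is honest), i.e.
`‖θ(t)‖ ≤ I(t) := ∫₀ᵗ √G(s,t) ds`; split at `s₀`: `I ≤ s₀‖h‖ + ∫_{s₀}^t √(m(t-s)) √(G(s,t)/m(t-s)) ds`, Cauchy–Schwarz
in `s` (`integral_mul_le_Lp_mul_Lq_of_nonneg`, `p = q = 2`): `‖θ(t)‖² ≤ 2s₀²‖h‖² + 2M·J(t)`,
`J(t) := ∫_{s₀}^t G(s,t)/m(t-s) ds = ∫₀^{t-s₀} G(t-τ,t)/m(τ) dτ` (`intervalIntegral.integral_comp_sub_left`); integrate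
`t ∈ [0,T]` (`J` is measurable in `t` by `StronglyMeasurable.integral_prod_right'` and bounded by `‖h‖²T/m(T)`), swap
the integrals on the triangle `{s₀ ≤ t ≤ T, 0 ≤ τ ≤ t - s₀}` (`integral_integral_swap` on a rectangle with an
indicator): `∫₀ᵀ J = ∫₀^{T-s₀} m(τ)⁻¹ (∫_{τ+s₀}^{T} G(t-τ,t) dt) dτ = ∫₀^{T-s₀} m(τ)⁻¹ (∫_{s₀}^{T-τ} G(s,s+τ) ds) dτ`
`≤ ∫₀^{T-s₀} m(τ)⁻¹ (B + T) m(τ)² ‖h‖² dτ ≤ (B+T) M ‖h‖²`.  [folklore: Duhamel + Green–Kubo bookkeeping] -/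
theorem stub_meanSquareDuhamelVariance :
    ∀ (κ s₀ B M : ℝ) (u : ℝ → UnitAddTorus (Fin 2) → EuclideanSpace ℝ (Fin 2)) (h : UnitAddTorus (Fin 2) → ℝ)
      (θ : ℝ → UnitAddTorus (Fin 2) → ℝ) (φ : ℝ → ℝ → UnitAddTorus (Fin 2) → ℝ) (m : ℝ → ℝ) (G : ℝ × ℝ → ℝ),
      0 < κ → Torus.IsSmooth h →
      Torus.IsClassicalScalarTransportForcedOn (Set.Ici 0) κ u (fun _ => h) θ → θ 0 = (fun _ => (0 : ℝ)) →
      (∀ s, 0 ≤ s → Torus.IsClassicalScalarTransportOn (Set.Ici s) κ u (φ s) ∧ φ s s = h) →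
      (∀ χ : UnitAddTorus (Fin 2) → ℝ, Torus.IsSmooth χ → ∀ t, 0 ≤ t →
          ∫ x, θ t x * χ x = ∫ s in (0 : ℝ)..t, ∫ x, φ s t x * χ x) →
      Measurable G → (∀ s t, 0 ≤ s → s ≤ t → G (s, t) = Torus.scalarL2Sq (φ s t)) →
      0 ≤ s₀ → 0 ≤ B → Antitone m → (∀ τ, 0 < m τ) → (∀ t, 0 ≤ t → ∫ τ in (0 : ℝ)..t, m τ ≤ M) →
      (∀ τ T, 0 ≤ τ → s₀ ≤ T →
          ∫ s in s₀..T, Torus.scalarL2Sq (φ s (s + τ)) ≤ (B + (T - s₀)) * m τ ^ 2 * Torus.scalarL2Sq h) →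
      ∀ T, 0 ≤ T →
        ∫ t in (0 : ℝ)..T, Torus.scalarL2Sq (θ t) ≤ (2 * s₀ ^ 2 * T + 2 * M ^ 2 * (B + T)) * Torus.scalarL2Sq h :=
  Summit.AnomalousDissipation.AnomalousDissipation.Theorems.ScalarAnomalySteadySourceFormal.MeanSquareDuhamelVariance.stub_meanSquareDuhamelVariance

/-! ## D2' — dissipation floor from liminf-mean power and linearly growing integrated variance -/

/-- **D2' `stub_dissipationFloorOfMeanVariance` (M).**  For a classical solution `θ` of `∂ₜθ + u·∇θ = κΔθ + h` on
`[0, ∞) × T²` (`κ ≥ 0`, `h` smooth) with `∫₀ᵀ ‖θ(t)‖² dt ≤ a + bT` (`T ≥ 0`) and a liminf-mean input-power floor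
`ε ≤ liminf_T T⁻¹∫₀ᵀ (h, θ(t)) dt`, the limsup-mean dissipation (spectral `Torus.eScalarGradNormSq`, `toReal`) is `≥ ε`.
(For `ε ≤ 0`: `longTimeAvgSup_nonneg`.)  PROOF ROUTE (twin of D2 p89988, `TwohalfdThesis.stub_dissipationFloor`, whose
file supplies `dissipationFloor_balance` / `dissipationFloor_timeMean_eq` / `dissipationFloor_continuousOn_scalarGradNormSq`):
the sourced `L²` balance `T⁻¹∫₀ᵀ κ‖∇θ‖² = T⁻¹∫₀ᵀ (h,θ) − (‖θ(T)‖² − ‖θ(0)‖²)/(2T)`; NEW: `‖θ(T)‖² = o(T)` — with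
`e(t) = ‖θ(t)‖²`, `e' = −2κ‖∇θ‖² + 2(h,θ) ≤ 2‖h‖√e` gives `d/dt √(e+1) ≤ ‖h‖`, so `√(e(t)+1) ≥ √(e(T)+1) − ‖h‖(T−t)`
on `[0,T]`; integrating `e` over the last `√(e(T)+1)/(2‖h‖)` units of time (or over `[0,T]` if shorter) against
`∫₀ᵀ e ≤ a + bT` yields `e(T) + 1 ≤ max ((8‖h‖(a+bT) + …)^{2/3}, 4(a+bT)/T + …) = o(T)` (`h = 0`: `e` antitone); the power
means are bounded (`|T⁻¹∫₀ᵀ(h,θ)| ≤ ‖h‖ (T⁻¹∫₀ᵀ e)^{1/2} ≤ ‖h‖√(a/T + b)`), so `eventually_lt_of_lt_liminf` and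
`le_limsup_of_frequently_le` (coboundedness from the Cesàro bounds) give `ε − δ ≤ ⟨κ‖∇θ‖²⟩` for every `δ > 0`;
`scalarGradNormSq_eq_toReal` converts to the spectral form.  [folklore] -/
theorem stub_dissipationFloorOfMeanVariance :
    ∀ (κ a b ε : ℝ) (u : ℝ → UnitAddTorus (Fin 2) → EuclideanSpace ℝ (Fin 2)) (h : UnitAddTorus (Fin 2) → ℝ)
      (θ : ℝ → UnitAddTorus (Fin 2) → ℝ),
      0 ≤ κ → Torus.IsSmooth h →
      Torus.IsClassicalScalarTransportForcedOn (Set.Ici 0) κ u (fun _ => h) θ →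
      (∀ T, 0 ≤ T → ∫ t in (0 : ℝ)..T, Torus.scalarL2Sq (θ t) ≤ a + b * T) →
      ε ≤ liminf (timeMean fun t => ∫ x, h x * θ t x) atTop →
      ε ≤ longTimeAvgSup (fun t => κ * (Torus.eScalarGradNormSq (θ t)).toReal) :=
  Summit.AnomalousDissipation.AnomalousDissipation.Theorems.ScalarAnomalySteadySourceFormal.DissipationFloorOfMeanVariance.stub_dissipationFloorOfMeanVariance

/-! ## J3 — the sibling kernel W implies S1'' -/

/-- **J3 `stub_meanSquare_of_releasedMixingWitness` (M−).**  The body of the sibling crux's kernel W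
(`TwohalfdThesis.stub_releasedMixingWitness`, verbatim: pointwise envelope `‖φ_j s(t)‖² ≤ Λ(t−s)²‖h‖²` for
`s₀ ≤ s ≤ t`, `Λ ≥ 0` integrable on `[0,∞)` with `∫Λ ≤ M`) implies the body of S1'' with the SAME objects and
`m(τ) := Λ⁎(τ) + e^{−τ}`, `Λ⁎(τ) := inf_{[0,τ]} Λ` (antitone, `≤ Λ`, and still an envelope by `L²`-contraction of the
releases, `IsClassicalScalarTransportOn.antitoneOn_scalarL2Sq`), `B := 0`, `M := M + 1`: the (MS) integral is bounded
by `integral_mono_of_nonneg` against the constant `m(τ)²‖h‖²` (no measurability of the release norms needed).  With the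
landed J2 `TwohalfdThesis.stub_releasedMixingWitness_of_profileMixerRealizable` (S1' ⇒ W, p132866) also S1' ⇒ S1''.
[folklore] -/
theorem stub_meanSquare_of_releasedMixingWitness :
    (∃ (g : (UnitAddTorus (Fin 2)) → (EuclideanSpace ℝ (Fin 2))) (h : (UnitAddTorus (Fin 2)) → ℝ),
      Torus.IsSmooth g ∧ Torus.IsDivFree g ∧ Torus.HasZeroMean g ∧ Torus.IsSmooth h ∧ Torus.HasZeroMean h ∧
      ∃ (ν : ℕ → ℝ) (v : ℕ → ℝ → (UnitAddTorus (Fin 2)) → (EuclideanSpace ℝ (Fin 2)))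
        (p : ℕ → ℝ → (UnitAddTorus (Fin 2)) → ℝ) (φ : ℕ → ℝ → ℝ → (UnitAddTorus (Fin 2)) → ℝ)
        (Λ : ℝ → ℝ) (E s₀ M ε : ℝ),
        (∀ j, 0 < ν j) ∧ Tendsto ν atTop (𝓝 0) ∧
        (∀ j, Torus.IsClassicalNSSolutionOn (Ici 0) (ν j) (fun _ => g) (v j) (p j)) ∧
        (∀ j t, 0 ≤ t → ∫ x, ‖v j t x‖ ^ 2 ≤ E) ∧
        (∀ j s, 0 ≤ s → Torus.IsClassicalScalarTransportOn (Ici s) (ν j) (v j) (φ j s) ∧ φ j s s = h) ∧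
        0 ≤ s₀ ∧ (∀ τ, 0 ≤ Λ τ) ∧ IntegrableOn Λ (Ici 0) ∧ (∫ τ in Ici 0, Λ τ) ≤ M ∧
        (∀ j s t, s₀ ≤ s → s ≤ t → Torus.scalarL2Sq (φ j s t) ≤ Λ (t - s) ^ 2 * Torus.scalarL2Sq h) ∧
        0 < ε ∧
        (∀ j, ε ≤ liminf (timeMean fun t => ∫ s in (0 : ℝ)..t, ∫ x, h x * φ j s t x) atTop)) →
    ∃ (g : UnitAddTorus (Fin 2) → EuclideanSpace ℝ (Fin 2)) (h : UnitAddTorus (Fin 2) → ℝ),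
      Torus.IsSmooth g ∧ Torus.IsDivFree g ∧ Torus.HasZeroMean g ∧ Torus.IsSmooth h ∧ Torus.HasZeroMean h ∧
      ∃ (ν : ℕ → ℝ) (v : ℕ → ℝ → UnitAddTorus (Fin 2) → EuclideanSpace ℝ (Fin 2))
        (p : ℕ → ℝ → UnitAddTorus (Fin 2) → ℝ) (φ : ℕ → ℝ → ℝ → UnitAddTorus (Fin 2) → ℝ)
        (m : ℝ → ℝ) (E s₀ B M ε : ℝ),
        (∀ j, 0 < ν j) ∧ Tendsto ν atTop (𝓝 0) ∧
        (∀ j, Torus.IsClassicalNSSolutionOn (Set.Ici 0) (ν j) (fun _ => g) (v j) (p j)) ∧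
        (∀ j t, 0 ≤ t → ∫ x, ‖v j t x‖ ^ 2 ≤ E) ∧
        (∀ j s, 0 ≤ s → Torus.IsClassicalScalarTransportOn (Set.Ici s) (ν j) (v j) (φ j s) ∧ φ j s s = h) ∧
        0 ≤ s₀ ∧ 0 ≤ B ∧ Antitone m ∧ (∀ τ, 0 < m τ) ∧ (∀ t, 0 ≤ t → ∫ τ in (0 : ℝ)..t, m τ ≤ M) ∧
        (∀ j τ T, 0 ≤ τ → s₀ ≤ T →
          ∫ s in s₀..T, Torus.scalarL2Sq (φ j s (s + τ)) ≤ (B + (T - s₀)) * m τ ^ 2 * Torus.scalarL2Sq h) ∧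
        0 < ε ∧
        (∀ j, ε ≤ liminf (timeMean fun t => ∫ s in (0 : ℝ)..t, ∫ x, h x * φ j s t x) atTop) :=
  Summit.AnomalousDissipation.AnomalousDissipation.Theorems.ScalarAnomalySteadySourceFormal.MeanSquareOfReleasedMixingWitness.stub_meanSquare_of_releasedMixingWitness

/-! ## Cesàro bookkeeping (proved): a linearly growing integral has `limsup` mean at most its slope -/

/-- If `f ≥ 0` and `∫₀ᵀ f ≤ a + bT` for all `T ≥ 0`, then `⟨f⟩ = limsup_T T⁻¹∫₀ᵀ f ≤ b` (the running means are
`≤ a/T + b`, eventually `≤ b + δ` for every `δ > 0`; nonnegativity supplies the coboundedness of the real `limsup`,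
`longTimeAvgSup_le_of_eventually_le`). [folklore] -/
theorem longTimeAvgSup_le_of_integral_le_linear {f : ℝ → ℝ} {a b : ℝ} (hf : ∀ t, 0 ≤ f t)
    (hint : ∀ T, 0 ≤ T → ∫ t in (0 : ℝ)..T, f t ≤ a + b * T) : longTimeAvgSup f ≤ b := by
  refine le_of_forall_pos_le_add fun δ hδ => ?_
  apply longTimeAvgSup_le_of_eventually_le hf
  have ha : 0 ≤ a := by simpa using hint 0 le_rfl
  filter_upwards [eventually_ge_atTop (max 1 (a / δ))] with T hT
  have hT1 : 1 ≤ T := le_trans (le_max_left _ _) hT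
  have hT0 : 0 < T := lt_of_lt_of_le one_pos hT1
  have hTa : a / δ ≤ T := le_trans (le_max_right _ _) hT
  have haT : a ≤ δ * T := by
    rw [div_le_iff₀ hδ] at hTa
    linarith [mul_comm T δ]
  unfold timeMean
  rw [inv_mul_le_iff₀ hT0]
  calc ∫ t in (0 : ℝ)..T, f t ≤ a + b * T := hint T hT0.le
    _ ≤ δ * T + b * T := by linarith
    _ = T * (b + δ) := by ring

/-! ## Composition — the crux BY NAME from S1'', T3a, T3, D2' (and the landed D0, cold starts) -/

/-- **`ScalarAnomalySteadySourceFormal_of`** (reshape r2): S1'' gives `(g, h)`, the classical NS family, the released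
families with mean-square decay and the Green–Kubo floor; the global cold starts `θ_j` exist
(`ColdStartVariance.exists_global_coldStart`); D0 (landed `TwohalfdThesis.stub_weakDuhamel`) is the weak Duhamel
identity; T3a + T3 bound `∫₀ᵀ‖θ_j‖² ≤ (2s₀²T + 2M²(B+T))‖h‖²`, whence the limsup-mean variance is
`≤ (2s₀² + 2M²)‖h‖²` (`longTimeAvgSup_le_of_integral_le_linear`); the GK floor rewritten through D0 (`χ = h`) is a
liminf-mean input-power floor and D2' turns it into `⟨ν_j‖∇θ_j‖²⟩ ≥ ε`; classical NS ⇒ global Leray–Hopf from its own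
slice (`IsClassicalNSSolutionOn.isLerayHopfOn_of_convex`), classical ⇒ weak sourced
(`Negative.isWeakScalarTransportForcedOn_of_classical`), pointwise energy ⇒ `meanEnergy ≤ E`
(`meanEnergy_le_of_forall_le`).  Only `sorry` meant to stay: S1''. -/
theorem ScalarAnomalySteadySourceFormal_of :
    Summit.AnomalousDissipation.AnomalousDissipation.Theses.TwoAndHalfD.ScalarAnomalySteadySourceFormal := by
  obtain ⟨g, h, hgs, hgd, hgm, hhs, hhm, ν, v, p, φ, m, E, s₀, B, M, ε, hν, hν0, hNS, hE, hφ, hs₀, hB, hanti, hpos,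
    hM, hMS, hε, hGK⟩ := stub_meanSquareMixerRealizable
  -- the classical cold starts `θ_j`
  have hex : ∀ j, ∃ θ : ℝ → UnitAddTorus (Fin 2) → ℝ,
      Torus.IsClassicalScalarTransportForcedOn (Set.Ici 0) (ν j) (v j) (fun _ => h) θ ∧ θ 0 = fun _ => 0 := fun j =>
    Summit.AnomalousDissipation.AnomalousDissipation.Theorems.ScalarAnomalySteadySourceFormal.ColdStartVariance.exists_global_coldStart
      (hν j) (hNS j).smooth_velocity (hNS j).divFree hhs
  choose θ hθ hθ0 using hex
  -- D0 (landed): the weak Duhamel identity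
  have hId : ∀ j (χ : UnitAddTorus (Fin 2) → ℝ), Torus.IsSmooth χ → ∀ t, 0 ≤ t →
      ∫ x, θ j t x * χ x = ∫ s in (0 : ℝ)..t, ∫ x, φ j s t x * χ x := fun j =>
    Summit.AnomalousDissipation.AnomalousDissipation.Theorems.TwohalfdThesis.stub_weakDuhamel
      (ν j) (v j) h (θ j) (φ j) (hν j) hhs (hθ j) (hθ0 j) (hφ j)
  -- T3a: measurable versions of the release norms
  have hG : ∀ j, ∃ G : ℝ × ℝ → ℝ, Measurable G ∧
      ∀ s t, 0 ≤ s → s ≤ t → G (s, t) = Torus.scalarL2Sq (φ j s t) := fun j =>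
    stub_releaseNormSqMeasurable (ν j) (v j) h (φ j) (hν j) hhs (hφ j)
  choose G hGm hGeq using hG
  -- T3: the integrated variance grows at most linearly
  have hInt : ∀ j T, 0 ≤ T → ∫ t in (0 : ℝ)..T, Torus.scalarL2Sq (θ j t) ≤
      (2 * s₀ ^ 2 * T + 2 * M ^ 2 * (B + T)) * Torus.scalarL2Sq h := fun j =>
    stub_meanSquareDuhamelVariance (ν j) s₀ B M (v j) h (θ j) (φ j) m (G j) (hν j) hhs (hθ j) (hθ0 j) (hφ j)
      (hId j) (hGm j) (hGeq j) hs₀ hB hanti hpos hM (hMS j)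
  have hInt' : ∀ j T, 0 ≤ T → ∫ t in (0 : ℝ)..T, Torus.scalarL2Sq (θ j t) ≤
      2 * M ^ 2 * B * Torus.scalarL2Sq h + (2 * s₀ ^ 2 + 2 * M ^ 2) * Torus.scalarL2Sq h * T := by
    intro j T hT
    have := hInt j T hT
    have e : (2 * s₀ ^ 2 * T + 2 * M ^ 2 * (B + T)) * Torus.scalarL2Sq h =
        2 * M ^ 2 * B * Torus.scalarL2Sq h + (2 * s₀ ^ 2 + 2 * M ^ 2) * Torus.scalarL2Sq h * T := by ring
    linarith
  -- limsup-mean variance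
  have hVar : ∀ j, longTimeAvgSup (fun t => Torus.scalarL2Sq (θ j t)) ≤
      (2 * s₀ ^ 2 + 2 * M ^ 2) * Torus.scalarL2Sq h := fun j =>
    longTimeAvgSup_le_of_integral_le_linear (fun t => Torus.scalarL2Sq_nonneg _) (hInt' j)
  -- the Green–Kubo floor is an input-power floor (D0 with `χ = h`)
  have hPow : ∀ j, ε ≤ liminf (timeMean fun t => ∫ x, h x * θ j t x) atTop := by
    intro j
    have heq : (timeMean fun t => ∫ s in (0 : ℝ)..t, ∫ x, h x * φ j s t x) =ᶠ[atTop]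
        (timeMean fun t => ∫ x, h x * θ j t x) := by
      filter_upwards [eventually_ge_atTop (0 : ℝ)] with T hT
      unfold timeMean
      congr 1
      refine intervalIntegral.integral_congr fun t ht => ?_
      rw [uIcc_of_le hT] at ht
      have e := hId j h hhs t ht.1
      simp_rw [mul_comm (h _)]
      exact e.symm
    rw [← Filter.liminf_congr heq]
    exact hGK j
  -- D2': the dissipation floor
  have hDiss : ∀ j, ε ≤ longTimeAvgSup (fun t => ν j * (Torus.eScalarGradNormSq (θ j t)).toReal) := fun j =>
    stub_dissipationFloorOfMeanVariance (ν j) (2 * M ^ 2 * B * Torus.scalarL2Sq h)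
      ((2 * s₀ ^ 2 + 2 * M ^ 2) * Torus.scalarL2Sq h) ε (v j) h (θ j) (hν j).le hhs (hθ j) (hInt' j) (hPow j)
  -- assemble the crux with data `v j 0`, `θ j 0`
  refine ⟨g, h, hgs, hgd, hgm, hhs, hhm, ν, fun j => v j 0, v, fun j => θ j 0, θ, hν, hν0, ?_, ?_, ?_,
    ⟨E, fun j => ?_⟩, ⟨(2 * s₀ ^ 2 + 2 * M ^ 2) * Torus.scalarL2Sq h, hVar⟩, ε, hε, hDiss⟩
  · -- classical NS on `[0, ∞)` ⇒ global Leray–Hopf with datum `v j 0`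
    intro j T hT
    exact (hNS j).isLerayHopfOn_of_convex (convex_Ici 0) hT Set.Icc_subset_Ici_self
  · -- the zero datum is in `L²`
    intro j
    exact ((hθ j).smooth_scalar.isSmooth_slice (le_refl (0 : ℝ))).memLp 2
  · -- classical cold start ⇒ global weak sourced solution
    intro j T _hT
    exact Summit.AnomalousDissipation.AnomalousDissipation.Theorems.ScalarAnomalySteadySourceFormal.Negative.isWeakScalarTransportForcedOn_of_classical
      (hθ j) Set.Icc_subset_Ici_self
  · -- pointwise energy bound ⇒ limsup-mean energy bound
    exact Literature.Barriers.AnomalousDissipation.meanEnergy_le_of_forall_le fun t ht => hE j t ht.le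

end Summit.AnomalousDissipation.AnomalousDissipation.Cruxes.ScalarAnomalySteadySourceFormal.BudgetedMixerTemplate

end
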